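import Mathlib.Analysis.SpecialFunctions.Pow.Real
import Mathlib.Tactic
import HarnessLib

/-!
# Format C, design C∞: expansion of the coupling-row kernels `1/(m²−i²)`, `m/(m²−i²)` in powers of `1/m`

Route context: Fourier–Galerkin / Schur-complement certificates of Weil positivity on a window ("format C", design C∞;
cell memo `run/shared/lean/pub/rh-explicit/rh-explicit-weil-2/gen9/CINF-GENERATOR-SPEC.md` B8/B9, item E2a; supporting
stmt-RiemannHypothesis-0098; seat rh-explicit-weil-2).

The coupling rows of the sector kernels are `M(i,m) = (−1)^{i+m}[(4s²/a)c_i c_m + (mF_m − iF_i)/(π(m²−i²))]`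
(`WeilFormatCColumnKernel`).  The C∞ generator expands them, for block index `i ≤ B` and column `m ≥ B₃ > B`, in the families `m^{−e}`:
this file is the exact finite expansion with remainder of the two rational kernels,

* `one_div_sq_sub_sq_expand`:  `1/(m²−i²) = Σ_{k<E} i^{2k}/m^{2k+2} + (i/m)^{2E}/(m²−i²)`,
* `self_div_sq_sub_sq_expand`: `m/(m²−i²) = Σ_{k<E} i^{2k}/m^{2k+1} + (i/m)^{2E}·m/(m²−i²)`,

and the remainder bounds for `0 ≤ i < m` (`…_remainder_nonneg`, `…_remainder_le`): `0 ≤ (i/m)^{2E}/(m²−i²) ≤ (i/m₀)^{2E}/(m²−i²)` for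
`m ≥ m₀ > i`, i.e. geometric decay `(B/B₃)^{2E}` uniformly on the tail.

Elementary algebra; standard axioms; no definitions; no RH claim.
-/

-- `Summit.RiemannHypothesis.RiemannHypothesis.…` is the layout-mandated namespace (summit = problem name).
set_option linter.dupNamespace false

noncomputable section

open Finset

namespace Summit.RiemannHypothesis.RiemannHypothesis.Theorems.WeilFormatC

/-- `1/(m²−i²) = Σ_{k<E} i^{2k}/m^{2k+2} + (i/m)^{2E}/(m²−i²)` (`m ≠ 0`, `m² ≠ i²`). -/
theorem one_div_sq_sub_sq_expand {i m : ℝ} (hm : m ≠ 0) (hmi : m ^ 2 - i ^ 2 ≠ 0) (E : ℕ) :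
    1 / (m ^ 2 - i ^ 2) = ∑ k ∈ range E, i ^ (2 * k) / m ^ (2 * k + 2) + (i / m) ^ (2 * E) / (m ^ 2 - i ^ 2) := by
  induction E with
  | zero => simp
  | succ E ih =>
    rw [ih, sum_range_succ, add_assoc, add_right_inj]
    rw [div_pow, div_pow]
    field_simp
    ring

/-- `m/(m²−i²) = Σ_{k<E} i^{2k}/m^{2k+1} + (i/m)^{2E}·m/(m²−i²)` (`m ≠ 0`, `m² ≠ i²`). -/
theorem self_div_sq_sub_sq_expand {i m : ℝ} (hm : m ≠ 0) (hmi : m ^ 2 - i ^ 2 ≠ 0) (E : ℕ) :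
    m / (m ^ 2 - i ^ 2) = ∑ k ∈ range E, i ^ (2 * k) / m ^ (2 * k + 1) + (i / m) ^ (2 * E) * m / (m ^ 2 - i ^ 2) := by
  have h := one_div_sq_sub_sq_expand hm hmi E
  have h2 : m / (m ^ 2 - i ^ 2) = m * (1 / (m ^ 2 - i ^ 2)) := by rw [mul_one_div]
  rw [h2, h, mul_add, mul_sum]
  congr 1
  · refine sum_congr rfl fun k _ ↦ ?_
    rw [pow_succ]
    field_simp
  · ring

/-- The remainder is non-negative for `0 ≤ i < m`. -/
theorem sq_sub_sq_remainder_nonneg {i m : ℝ} (hi : 0 ≤ i) (him : i < m) (E : ℕ) :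
    0 ≤ (i / m) ^ (2 * E) / (m ^ 2 - i ^ 2) := by
  have hm : 0 < m := hi.trans_lt him
  have : 0 < m ^ 2 - i ^ 2 := by nlinarith
  positivity

/-- The remainder decays geometrically, uniformly in `m ≥ m₀ > i ≥ 0`:
`(i/m)^{2E}/(m²−i²) ≤ (i/m₀)^{2E}/(m²−i²)`. -/
theorem sq_sub_sq_remainder_le {i m m₀ : ℝ} (hi : 0 ≤ i) (him : i < m₀) (hm : m₀ ≤ m) (E : ℕ) :
    (i / m) ^ (2 * E) / (m ^ 2 - i ^ 2) ≤ (i / m₀) ^ (2 * E) / (m ^ 2 - i ^ 2) := by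
  have hm₀ : 0 < m₀ := hi.trans_lt him
  have hmp : 0 < m := hm₀.trans_le hm
  have hden : 0 < m ^ 2 - i ^ 2 := by nlinarith
  gcongr

/-- The same bound for the `m/(m²−i²)` remainder: `(i/m)^{2E}·m/(m²−i²) ≤ (i/m₀)^{2E}·m/(m²−i²)`. -/
theorem self_sq_sub_sq_remainder_le {i m m₀ : ℝ} (hi : 0 ≤ i) (him : i < m₀) (hm : m₀ ≤ m) (E : ℕ) :
    (i / m) ^ (2 * E) * m / (m ^ 2 - i ^ 2) ≤ (i / m₀) ^ (2 * E) * m / (m ^ 2 - i ^ 2) := by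
  have hm₀ : 0 < m₀ := hi.trans_lt him
  have hmp : 0 < m := hm₀.trans_le hm
  have hden : 0 < m ^ 2 - i ^ 2 := by nlinarith
  gcongr

/-- Crude size of the remainder denominators on the tail: for `0 ≤ i ≤ B < m`, `1/(m²−i²) ≤ 1/(m² − B²)`. -/
theorem one_div_sq_sub_sq_le {i m B : ℝ} (hi : 0 ≤ i) (hiB : i ≤ B) (hBm : B < m) :
    1 / (m ^ 2 - i ^ 2) ≤ 1 / (m ^ 2 - B ^ 2) := by
  have h1 : 0 < m ^ 2 - B ^ 2 := by nlinarith
  have h2 : m ^ 2 - B ^ 2 ≤ m ^ 2 - i ^ 2 := by nlinarith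
  exact one_div_le_one_div_of_le h1 h2

end Summit.RiemannHypothesis.RiemannHypothesis.Theorems.WeilFormatC

end
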